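/-
Copyright (c) 2026. All rights reserved.
Released under Apache 2.0 license as described in the file LICENSE.
Authors: abc-iut cell, wave-2 prover seat abc-iut-L3-t11 (proof-only companion; discharge item G4b of
plan/L3/DISCHARGE-L3.md).
-/
import Mathlib.Combinatorics.SimpleGraph.Acyclic
import Literature.AnabelianGeometry.SemiGraphs.FreeGroupsAndActions

/-!
# [SemiAnbd] Lemma 1.8 (ii)(b): a finite group fixing two vertices of a tree fixes the geodesic (proof)

Mochizuki, *Semi-graphs of Anabelioids*, Publ. RIMS **42** (2006) 221–322, §1, author's manuscript
p. 20, Lemma 1.8 (ii)(b) [cite: MochizukiSemiAnbd2006, Lem. 1.8(ii)(b) p.20]: `G` a tree with an action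
of a finite group `Γ`; "if `Γ` fixes two distinct vertices `w_1`, `w_2` of `G`, then `Γ` acts trivially on
any “geodesic” [i.e., path of closed edges of minimal length] that joins `w_1`, `w_2`" ("implicit in the
theory of [Serre]").

This PROOF-ONLY companion of `FreeGroupsAndActions.lean` (seat abc-iut-L3-t1, p404224) discharges the
named fact `SemiGraph.lemma_1_8_ii_b` AS TYPED (`lemma_1_8_ii_b_holds`). Route (the standard one):
an automorphism `σ` of the semi-graph `G` induces an INJECTIVE graph endomorphism `nodeMap σ` of the
barycentric subdivision `G.subdivision` (functoriality of the subdivision — cf. abc-iut-L3-t6's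
`SubdivisionLemmas.subdivision_adj_map`, p404972, re-derived here in four lines from the two
constructors of `NodeRel` so that this file imports only BUILT modules; injectivity from
`σ.hom ≫ σ.inv = 𝟙`); a walk of minimal length is a
path (Mathlib `Walk.isPath_of_length_eq_dist`); its image under `nodeMap σ` is again a path between the
SAME endpoints (these are fixed); in a tree two paths with the same endpoints coincide (Mathlib
`IsAcyclic.path_unique`); so `nodeMap σ` fixes the support pointwise. Finiteness of `Γ` is not used
for (ii)(b). No definitions; nothing here bears on anything disputed.
-/

namespace Literature.AnabelianGeometry.SemiGraphs

namespace SemiGraph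

open CategoryTheory

universe u

variable {G : SemiGraph.{u}}

/-! ### Automorphisms of a semi-graph act by injective graph endomorphisms of the subdivision -/

/-- For an automorphism `σ` of `G`, `σ⁻¹ ∘ σ = id` on vertices. [cite: MochizukiSemiAnbd2006, Lem. 1.8 p.20] -/
theorem inv_vertexMap_hom_vertexMap (σ : Aut G) (v : G.Vertex) :
    σ.inv.vertexMap (σ.hom.vertexMap v) = v := by
  have h := congrArg Hom.vertexMap σ.hom_inv_id
  rw [comp_vertexMap, id_vertexMap] at h
  exact congrFun h v

/-- For an automorphism `σ` of `G`, `σ⁻¹ ∘ σ = id` on edges. [cite: MochizukiSemiAnbd2006, Lem. 1.8 p.20] -/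
theorem inv_edgeMap_hom_edgeMap (σ : Aut G) (e : G.Edge) : σ.inv.edgeMap (σ.hom.edgeMap e) = e := by
  have h := congrArg Hom.edgeMap σ.hom_inv_id
  rw [comp_edgeMap, id_edgeMap] at h
  exact congrFun h e

/-- For an automorphism `σ` of `G`, `σ⁻¹ ∘ σ = id` on branches. [cite: MochizukiSemiAnbd2006, Lem. 1.8 p.20] -/
theorem inv_branchMap_hom_branchMap (σ : Aut G) (b : G.Branch) :
    σ.inv.branchMap (σ.hom.branchMap b) = b := by
  have h := congrArg Hom.branchMap σ.hom_inv_id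
  rw [comp_branchMap, id_branchMap] at h
  exact congrFun h b

/-- `nodeMap σ⁻¹ ∘ nodeMap σ = id` on the nodes of the subdivision. [cite: MochizukiSemiAnbd2006, Lem. 1.8(ii) p.20] -/
theorem nodeMap_symm_nodeMap (σ : Aut G) (x : G.Node) : nodeMap σ.symm (nodeMap σ x) = x := by
  rcases x with v | e | b
  · simp [nodeMap, inv_vertexMap_hom_vertexMap]
  · simp [nodeMap, inv_edgeMap_hom_edgeMap]
  · simp [nodeMap, inv_branchMap_hom_branchMap]

/-- The action of an automorphism on the nodes of the subdivision is injective.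
[cite: MochizukiSemiAnbd2006, Lem. 1.8(ii) p.20] -/
theorem nodeMap_injective (σ : Aut G) : Function.Injective (nodeMap σ) :=
  Function.LeftInverse.injective (nodeMap_symm_nodeMap σ)

/-- An automorphism of `G` maps incident nodes to incident nodes (morphisms are compatible with the
edges and the coincidence maps, p. 11). [cite: MochizukiSemiAnbd2006, Lem. 1.8(ii) p.20] -/
theorem nodeRel_nodeMap (σ : Aut G) {x y : G.Node} (h : G.NodeRel x y) :
    G.NodeRel (nodeMap σ x) (nodeMap σ y) := by
  rcases h with ⟨b⟩ | ⟨b, v, h⟩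
  · have h1 := NodeRel.edge_branch (G := G) (σ.hom.branchMap b)
    rw [σ.hom.edgeOf_branchMap] at h1
    exact h1
  · exact NodeRel.branch_vertex _ _ (σ.hom.abuts_branchMap b v h)

/-- An automorphism of `G` preserves adjacency in the barycentric subdivision (functoriality of the
subdivision; cf. abc-iut-L3-t6's `subdivision_adj_map`). [cite: MochizukiSemiAnbd2006, Lem. 1.8(ii) p.20] -/
theorem subdivision_adj_nodeMap (σ : Aut G) {x y : G.Node} (h : G.subdivision.Adj x y) :
    G.subdivision.Adj (nodeMap σ x) (nodeMap σ y) := by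
  change (SimpleGraph.fromRel G.NodeRel).Adj _ _ at h
  change (SimpleGraph.fromRel G.NodeRel).Adj _ _
  rw [SimpleGraph.fromRel_adj] at h ⊢
  obtain ⟨hne, h⟩ := h
  refine ⟨(nodeMap_injective σ).ne hne, ?_⟩
  rcases h with h | h
  · exact Or.inl (nodeRel_nodeMap σ h)
  · exact Or.inr (nodeRel_nodeMap σ h)

/-- On a vertex-point, `nodeMap σ` is `σ` on vertices. [cite: MochizukiSemiAnbd2006, Lem. 1.8(ii) p.20] -/
@[simp] theorem nodeMap_inl (σ : Aut G) (v : G.Vertex) :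
    nodeMap σ (Sum.inl v) = Sum.inl (σ.hom.vertexMap v) := rfl

/-- On an edge-point, `nodeMap σ` is `σ` on edges. [cite: MochizukiSemiAnbd2006, Lem. 1.8(ii) p.20] -/
@[simp] theorem nodeMap_inr_inl (σ : Aut G) (e : G.Edge) :
    nodeMap σ (Sum.inr (Sum.inl e)) = Sum.inr (Sum.inl (σ.hom.edgeMap e)) := rfl

/-- On a branch-point, `nodeMap σ` is `σ` on branches. [cite: MochizukiSemiAnbd2006, Lem. 1.8(ii) p.20] -/
@[simp] theorem nodeMap_inr_inr (σ : Aut G) (b : G.Branch) :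
    nodeMap σ (Sum.inr (Sum.inr b)) = Sum.inr (Sum.inr (σ.hom.branchMap b)) := rfl

/-! ### Paths in the subdivision of a tree with fixed endpoints are fixed pointwise -/

/-- **Core of Lemma 1.8 (ii)(b)**: if the subdivision of `G` is acyclic and an automorphism `σ` fixes the
two endpoints of a PATH `p` of the subdivision, then `σ` fixes every node on `p` (the image of `p` is a
path with the same endpoints, hence equals `p`). [cite: MochizukiSemiAnbd2006, Lem. 1.8(ii)(b) p.20] -/
theorem nodeMap_eq_self_of_isPath (hG : G.subdivision.IsAcyclic) (σ : Aut G) {x y : G.Node}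
    (hx : nodeMap σ x = x) (hy : nodeMap σ y = y) (p : G.subdivision.Walk x y) (hp : p.IsPath) :
    ∀ z ∈ p.support, nodeMap σ z = z := by
  -- the induced graph endomorphism of the subdivision
  let f : G.subdivision →g G.subdivision :=
    { toFun := nodeMap σ, map_rel' := fun h => subdivision_adj_nodeMap σ h }
  have hf : Function.Injective f := nodeMap_injective σ
  -- the image path, transported back to the endpoints `x`, `y`
  let q : G.subdivision.Walk x y := (p.map f).copy hx hy
  have hq : q.IsPath := by
    simp only [q, SimpleGraph.Walk.isPath_copy]
    exact hp.map hf
  have hpq : q = p := by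
    have := hG.path_unique ⟨q, hq⟩ ⟨p, hp⟩
    exact congrArg Subtype.val this
  have hsupp : p.support.map f = p.support := by
    have h1 : q.support = (p.support).map f := by
      simp only [q, SimpleGraph.Walk.support_copy, SimpleGraph.Walk.support_map]
    rw [← h1, hpq]
  intro z hz
  have h2 : p.support.map f = p.support.map id := by rw [hsupp, List.map_id]
  exact (List.map_eq_map_iff.mp h2) z hz

/-- **[SemiAnbd] Lemma 1.8 (ii)(b), PROVED as typed**: `G` a tree with an action `ρ : Γ →* Aut G` of a
(finite) group; if `Γ` fixes two distinct vertices `w₁`, `w₂`, then `Γ` acts trivially on every geodesic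
(walk of minimal length in the barycentric subdivision) joining them — every vertex, edge-point and
branch-point on it is fixed. [cite: MochizukiSemiAnbd2006, Lem. 1.8(ii)(b) p.20] -/
theorem lemma_1_8_ii_b_holds : lemma_1_8_ii_b.{u} := by
  intro G Γ _ _ ρ hG w₁ w₂ _ hw₁ hw₂ p hp x hx γ
  have hpath : p.IsPath := p.isPath_of_length_eq_dist hp
  exact nodeMap_eq_self_of_isPath hG.isTree.isAcyclic (ρ γ) (by simp [hw₁ γ]) (by simp [hw₂ γ]) p
    hpath x hx

end SemiGraph

end Literature.AnabelianGeometry.SemiGraphs
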